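import Summits.CriticalPhenomena.Ising3DConformalLimit.Theorems.ArmHyperscalingMergingFloorOneArmGivesMatchedIsotherm

/-!
# One-arm hyperscaling + simultaneous good scales ⟹ the matched upper critical isotherm FREQUENTLY
# (content of stub S3 `stub_matchedIsothermFrequently_of_oneArm` of line `one_arm_saturation`, crux 4945)

Route `LeeYangGap` (Ising3DConformalLimit), crux `NearCriticalLeeYangGap` (GAP, item stmt-CriticalPhenomena-4945),
line `one_arm_saturation` (`Cruxes/NearCriticalLeeYangGap/Lines/one_arm_saturation.lean`, strategist s1, 2026-08-17).
That line reduces GAP to ONE-ARM HYPERSCALING (item stmt-CriticalPhenomena-15591,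
`ArmHyperscaling.OneArmHyperscaling`: `(⟨σ₀⟩⁺_{Λ_{Kn},β_c})² ≤ C₀⟨σ₀σ_{2ne₀}⟩_{β_c}`) through the matched upper critical
isotherm `(2L+1)³·m(β_c, C/√Σ_L) ≤ ½β_c C√Σ_L` at infinitely many block scales `L`, with two elementary stubs:
S2 `stub_simultaneousScales` (field-term doubling (F) and axis ratio (B) hold simultaneously at infinitely many
`L`, from the critical envelopes alone) and S3 `stub_matchedIsothermFrequently_of_oneArm` (one-arm + S2 ⟹ matched
isotherm frequently). This file proves the CONTENT of S3 with the line's definitions `SimultaneousScales`,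
`Matched`, `MatchedIsothermFrequently` unfolded (they live in the Cruxes skeleton, which a Theorems file does not
import): `matchedIsothermFrequently_of_oneArm_of_simultaneousScales`. In the skeleton, S3 becomes the one-liner
`fun h₁ h₂ => matchedIsothermFrequently_of_oneArm_of_simultaneousScales h₁ h₂` (definitional unfolding).

Proof = the landed `ArmHyperscalingMergingFloor.stub_oneArmGivesMatchedIsotherm` (crux 15592, stub S4; there
under a scale-covariant pointwise limit, which supplied (F) and (B) EVENTUALLY via `exists_eta_boxSum_floor_le`
and `eventually_axis_ratio`) with `filter_upwards [hdbl, hratio, …]` replaced by `Frequently.mono` on the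
conjunction (F) ∧ (B) supplied FREQUENTLY by the hypothesis: at such an `L`, with `K, C₀` from one-arm
hyperscaling, `t = η₀/K`, `n = ⌊tL⌋`, `N = Kn ≤ ⌊η₀L⌋`: Step 1 `mag_le_boxMag_add` (GHS tangent + GKS
localisation) `m(β_c,h) ≤ a(N) + β_cχ(N)h`; Step 2 (field term, (F) + `card_mul_boxSum_le_blockSum`)
`V_Lχ(N) ≤ Σ_L/4`; Step 3 (boundary term, one-arm + (B) + `card_sq_mul_axis_le_blockSum`) `(V_La(N))² ≤ 729C₀⁺R·Σ_L`;
Step 4 `matched_arith` with `C = 4(√A+1)/β_c`, `A = 729·max(C₀,0)·R`. No scaling-limit hypothesis anywhere.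
-/

noncomputable section

namespace Summit.CriticalPhenomena.Ising3DConformalLimit.LeeYangGapNearCriticalLeeYangGap

open Literature.Probability.LatticeModels Filter Set Finset
open scoped Topology BigOperators
open Summit.CriticalPhenomena.Ising3DConformalLimit.PerfectScreeningCoulombImpliesNontrivial
open Summit.CriticalPhenomena.Ising3DConformalLimit.LeeYangGapGaussianLimitKillsBlockCoupling
open Summit.CriticalPhenomena.Ising3DConformalLimit.ArmHyperscalingMergingFloor

/-- **S3 content — one-arm hyperscaling and simultaneous good scales give the matched upper critical isotherm
frequently.** If `OneArmHyperscaling` (item stmt-CriticalPhenomena-15591) holds and the good-scale conditions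
(F) `Σ_{Λ_{⌊ηL⌋}}G_c ≤ (1/108)Σ_{Λ_{L/2}}G_c` and (B) `G_c(2⌊tL⌋e₀) ≤ R·G_c(2Le₀)` hold SIMULTANEOUSLY for
infinitely many `L` (for all `0 < t ≤ η ≤ η₀`, some `R ≥ 0` — the line's `SimultaneousScales`, unfolded), then
there is `C > 0` with `(2L+1)³·m(β_c, C/√Σ_L) ≤ ½β_c C√Σ_L` for infinitely many `L` (the line's
`MatchedIsothermFrequently`, unfolded). -/
theorem matchedIsothermFrequently_of_oneArm_of_simultaneousScales
    (hOAH : Summit.CriticalPhenomena.Ising3DConformalLimit.Theses.ArmHyperscaling.OneArmHyperscaling)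
    (hSS : ∃ η₀ : ℝ, 0 < η₀ ∧ η₀ ≤ 1 ∧ ∀ η t : ℝ, 0 < t → t ≤ η → η ≤ η₀ →
      ∃ R : ℝ, 0 ≤ R ∧ ∃ᶠ L : ℕ in atTop,
        (∑ z ∈ box 3 ⌊η * L⌋₊, criticalTwoPoint 3 z ≤
            1 / 108 * ∑ z ∈ box 3 (L / 2), criticalTwoPoint 3 z) ∧
        criticalTwoPoint 3 (Pi.single 0 (2 * ((⌊t * L⌋₊ : ℕ) : ℤ))) ≤
          R * criticalTwoPoint 3 (Pi.single 0 ((2 * L : ℕ) : ℤ))) :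
    ∃ C : ℝ, 0 < C ∧ ∃ᶠ L : ℕ in atTop,
      (2 * (L : ℝ) + 1) ^ 3 * magnetizationInField 3 (criticalBeta 3)
          (C / Real.sqrt (plusExpect 3 (criticalBeta 3) 0 (fun σ => (∑ x ∈ box 3 L, spinAt x σ) ^ 2))) ≤
        criticalBeta 3 * C / 2 *
          Real.sqrt (plusExpect 3 (criticalBeta 3) 0 (fun σ => (∑ x ∈ box 3 L, spinAt x σ) ^ 2)) := by
  obtain ⟨K, hK, C₀, hOA⟩ := hOAH
  obtain ⟨η₀, hη0, hη1, hSS⟩ := hSS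
  have hβ : 0 < criticalBeta 3 := criticalBeta_pos_holds (d := 3) (by norm_num)
  -- the ratio `t = η₀/K ≤ η₀` and the simultaneous good scales at `(η, t) = (η₀, η₀/K)`
  have hKpos : (0 : ℝ) < K := by exact_mod_cast hK
  have hK1 : (1 : ℝ) ≤ K := by exact_mod_cast hK
  obtain ⟨t, ht⟩ : ∃ t : ℝ, η₀ / K = t := ⟨_, rfl⟩
  have ht0 : 0 < t := ht ▸ div_pos hη0 hKpos
  have hηt : (K : ℝ) * t = η₀ := by rw [← ht]; field_simp
  have htη : t ≤ η₀ := by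
    rw [← ht]
    exact div_le_self hη0.le hK1
  obtain ⟨R, hR0, hfreq⟩ := hSS η₀ t ht0 htη le_rfl
  -- constants
  have hC₁0 : 0 ≤ max C₀ 0 := le_max_right _ _
  obtain ⟨A, hA⟩ : ∃ A : ℝ, 729 * max C₀ 0 * R = A := ⟨_, rfl⟩
  have hA0 : 0 ≤ A := hA ▸ by positivity
  refine ⟨4 * (Real.sqrt A + 1) / criticalBeta 3, by positivity, ?_⟩
  have hβC : criticalBeta 3 * (4 * (Real.sqrt A + 1) / criticalBeta 3) / 4 = Real.sqrt A + 1 := by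
    field_simp
  have hev : ∀ᶠ L : ℕ in atTop, ⌈1 / t⌉₊ ≤ L ∧ 1 ≤ L :=
    (eventually_ge_atTop ⌈1 / t⌉₊).and (eventually_ge_atTop 1)
  refine (hfreq.and_eventually hev).mono ?_
  rintro L ⟨⟨hdL, hrL⟩, hLt, hL1⟩
  -- the scales `n = ⌊tL⌋ ≥ 1` and `N = K n ≤ ⌊η₀L⌋`
  have hn1 : 1 ≤ ⌊t * L⌋₊ := by
    have h2 : 1 / t ≤ (L : ℝ) := (Nat.le_ceil _).trans (by exact_mod_cast hLt)
    have h3 : (1 : ℝ) ≤ t * L := by rw [mul_comm]; exact (div_le_iff₀ ht0).1 h2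
    exact Nat.succ_le_of_lt (Nat.floor_pos.2 h3)
  have hNle : K * ⌊t * L⌋₊ ≤ ⌊η₀ * L⌋₊ := by
    refine Nat.le_floor ?_
    have h1 : (⌊t * L⌋₊ : ℝ) ≤ t * L := Nat.floor_le (by positivity)
    calc ((K * ⌊t * L⌋₊ : ℕ) : ℝ) = K * (⌊t * L⌋₊ : ℝ) := by push_cast; ring
      _ ≤ K * (t * L) := mul_le_mul_of_nonneg_left h1 hKpos.le
      _ = η₀ * L := by rw [← hηt]; ring
  -- the block variance `Σ_L > 0` and its two-point expansion
  have hSg : 0 < plusExpect 3 (criticalBeta 3) 0 (fun σ => (∑ x ∈ box 3 L, spinAt x σ) ^ 2) :=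
    sketchPub_blockVariance_pos L
  have hSg_eq := plusExpect_blockSpin_sq_eq_sum 3 L
  -- Step 1 at the matched field, in the box `Λ_{K n}`
  have hmag := mag_le_boxMag_add (N := K * ⌊t * L⌋₊) (h := 4 * (Real.sqrt A + 1) / criticalBeta 3 /
    Real.sqrt (plusExpect 3 (criticalBeta 3) 0 (fun σ => (∑ x ∈ box 3 L, spinAt x σ) ^ 2)))
    (by positivity)
  -- volumes: `V_L ≤ 27 |Λ_{L/2}|`
  have hVH : (2 * (L : ℝ) + 1) ^ 3 ≤ 27 * (#(box 3 (L / 2)) : ℝ) := by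
    have h1 : (2 * (L : ℝ) + 1) ^ 3 = (#(box 3 L) : ℝ) := by
      rw [card_box]; push_cast; ring
    rw [h1]
    exact (card_box_le L hL1).trans
      (mul_le_mul_of_nonneg_left (pow_three_le_card_box_half L) (by norm_num))
  have hV0 : (0 : ℝ) ≤ (2 * (L : ℝ) + 1) ^ 3 := by positivity
  -- Step 2, field term: `V_L χ(N) ≤ Σ_L / 4`
  have hfield : (2 * (L : ℝ) + 1) ^ 3 * (∑ z ∈ box 3 (K * ⌊t * L⌋₊), criticalTwoPoint 3 z) ≤
      plusExpect 3 (criticalBeta 3) 0 (fun σ => (∑ x ∈ box 3 L, spinAt x σ) ^ 2) / 4 := by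
    have h1 : ∑ z ∈ box 3 (K * ⌊t * L⌋₊), criticalTwoPoint 3 z ≤
        1 / 108 * ∑ z ∈ box 3 (L / 2), criticalTwoPoint 3 z := (boxSum_mono hNle).trans hdL
    have h2 : (#(box 3 (L / 2)) : ℝ) * ∑ z ∈ box 3 (L / 2), criticalTwoPoint 3 z ≤
        plusExpect 3 (criticalBeta 3) 0 (fun σ => (∑ x ∈ box 3 L, spinAt x σ) ^ 2) := by
      rw [hSg_eq]; exact card_mul_boxSum_le_blockSum (d := 3) L
    have hχ0 : 0 ≤ ∑ z ∈ box 3 (L / 2), criticalTwoPoint 3 z := boxSum_nonneg _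
    calc (2 * (L : ℝ) + 1) ^ 3 * (∑ z ∈ box 3 (K * ⌊t * L⌋₊), criticalTwoPoint 3 z)
        ≤ (27 * (#(box 3 (L / 2)) : ℝ)) * (1 / 108 * ∑ z ∈ box 3 (L / 2), criticalTwoPoint 3 z) :=
          mul_le_mul hVH h1 (boxSum_nonneg _) (by positivity)
      _ = ((#(box 3 (L / 2)) : ℝ) * ∑ z ∈ box 3 (L / 2), criticalTwoPoint 3 z) / 4 := by ring
      _ ≤ _ := by linarith
  -- Step 3, boundary term: `(V_L a(N))² ≤ A Σ_L`
  have hbdry : ((2 * (L : ℝ) + 1) ^ 3 *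
      isingExpect (zdGraph 3) (box 3 (K * ⌊t * L⌋₊)) (criticalBeta 3) 0 .plus (spinAt 0)) ^ 2 ≤
      A * plusExpect 3 (criticalBeta 3) 0 (fun σ => (∑ x ∈ box 3 L, spinAt x σ) ^ 2) := by
    have h1 : isingExpect (zdGraph 3) (box 3 (K * ⌊t * L⌋₊)) (criticalBeta 3) 0 .plus (spinAt 0) ^ 2 ≤
        max C₀ 0 * criticalTwoPoint 3 (Pi.single 0 (2 * ((⌊t * L⌋₊ : ℕ) : ℤ))) := by
      have h := hOA _ hn1
      have ha_corr : isingCorr (zdGraph 3) (box 3 (K * ⌊t * L⌋₊)) (criticalBeta 3) 0 .plus {0} =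
          isingExpect (zdGraph 3) (box 3 (K * ⌊t * L⌋₊)) (criticalBeta 3) 0 .plus (spinAt 0) := by
        simp [isingCorr]
      rw [ha_corr] at h
      exact h.trans (mul_le_mul_of_nonneg_right (le_max_left _ _) (criticalTwoPoint_nonneg' _))
    have h3 : (#(box 3 (L / 2)) : ℝ) ^ 2 * criticalTwoPoint 3 (Pi.single 0 ((2 * L : ℕ) : ℤ)) ≤
        plusExpect 3 (criticalBeta 3) 0 (fun σ => (∑ x ∈ box 3 L, spinAt x σ) ^ 2) := by
      rw [hSg_eq]; exact card_sq_mul_axis_le_blockSum L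
    have hG0 : 0 ≤ criticalTwoPoint 3 (Pi.single 0 ((2 * L : ℕ) : ℤ)) := criticalTwoPoint_nonneg' _
    have ha0 := boxMag_nonneg (K * ⌊t * L⌋₊)
    have hV2 : ((2 * (L : ℝ) + 1) ^ 3) ^ 2 ≤ 729 * (#(box 3 (L / 2)) : ℝ) ^ 2 := by nlinarith
    calc ((2 * (L : ℝ) + 1) ^ 3 *
          isingExpect (zdGraph 3) (box 3 (K * ⌊t * L⌋₊)) (criticalBeta 3) 0 .plus (spinAt 0)) ^ 2
        = ((2 * (L : ℝ) + 1) ^ 3) ^ 2 *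
          isingExpect (zdGraph 3) (box 3 (K * ⌊t * L⌋₊)) (criticalBeta 3) 0 .plus (spinAt 0) ^ 2 := by
          ring
      _ ≤ (729 * (#(box 3 (L / 2)) : ℝ) ^ 2) *
          (max C₀ 0 * (R * criticalTwoPoint 3 (Pi.single 0 ((2 * L : ℕ) : ℤ)))) :=
          mul_le_mul hV2 (h1.trans (mul_le_mul_of_nonneg_left hrL hC₁0)) (by positivity)
            (by positivity)
      _ = A * ((#(box 3 (L / 2)) : ℝ) ^ 2 * criticalTwoPoint 3 (Pi.single 0 ((2 * L : ℕ) : ℤ))) := by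
          rw [← hA]; ring
      _ ≤ _ := mul_le_mul_of_nonneg_left h3 hA0
  -- Step 4: assembly
  exact matched_arith hβ (by positivity) hSg hV0 hA0 hβC hmag hfield hbdry

end Summit.CriticalPhenomena.Ising3DConformalLimit.LeeYangGapNearCriticalLeeYangGap

end
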